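import Literature.Geometry.Lorentzian.LorentzianMetric
import Literature.Geometry.Lorentzian.CurvatureSymmetries
import HarnessLib

/-!
# Screen-space linear algebra at a null vector of a Lorentzian scalar product

Pointwise linear algebra behind the null Raychaudhuri / focusing argument (layer L4 of the proof
programme of `Literature.Geometry.Lorentzian.ChruscielEtAl2001_areaTheorem`; Chruściel–Delay–
Galloway–Howard 2001, Prop. 4.17 via O'Neill 1983, Ch. 10, Prop. 43; Hawking–Ellis 1973, §4.4,
Prop. 4.4.6; the "screen" or quotient bundle `ℓ^⊥/ℝℓ` of a null geodesic congruence, Galloway 2000,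
§2; Hawking–Ellis 1973, §4.2, the space `S_q` spanned by `E₃, E₄`). Everything is stated for a
symmetric bilinear form `B` on a finite-dimensional real vector space `V` which is **Lorentzian** in
the sense of `Literature.Geometry.Lorentzian.LorentzianMetric` — there is a vector `T` with
`B(T, T) < 0`, and `B` is positive definite on the `B`-orthogonal complement of every such vector
(O'Neill 1983, Ch. 5, Lemma 5.26) — and a **null** vector `ℓ` (`B(ℓ, ℓ) = 0`, `ℓ ≠ 0`); the
manifold-level statements are the instantiations `V = E`, `B = g_x`.

* `nonneg_of_orthogonal_null`: `B(w, w) ≥ 0` on `ℓ^⊥` (a timelike vector is never orthogonal to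
  a causal one, O'Neill 1983, Ch. 5, Lemma 5.26 / Cor. 5.27);
* `exists_smul_of_orthogonal_null`: `w ⊥ ℓ` and `B(w, w) = 0` force `w ∈ ℝℓ` (two orthogonal null
  vectors are collinear, Hawking–Ellis 1973, §4.2; O'Neill 1983, Ch. 5, p. 155, proof of Lemma 5.28);
* `not_linearIndependent_of_orthogonal_of_nonneg`: a family of `dim V` pairwise `B`-orthogonal
  vectors with `B(fₐ, fₐ) ≥ 0` is linearly dependent (otherwise `B ≥ 0` on `V = span f`,
  contradicting `B(T, T) < 0`);
* `exists_eq_sum_screen_add_smul`: for an orthonormal **screen frame** `e₁, …, e_m ⊥ ℓ` with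
  `m + 2 = dim V`, every `w ⊥ ℓ` is `∑ B(w, eᵢ) eᵢ + c ℓ` (`ℓ^⊥ = screen ⊕ ℝℓ`, Galloway 2000,
  §2, `T_pS/ℝK`);
* `exists_orthonormal_screen`: orthonormal screen frames exist: `{T, ℓ}^⊥` has dimension
  `dim V - 2` and `B` is positive definite there (`LinearMap.BilinForm.exists_orthogonal_basis`);
* `gram_eq_transpose_mul`: for vectors `J_k ⊥ ℓ` with screen coordinates `A = (B(J_k, eᵢ))ᵢₖ`
  the Gram matrix `(B(J_k, J_l))` is `Aᵀ A` (the `ℓ`-components drop out);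
* `exists_sum_smul_eq_smul_null_of_det_gram_eq_zero`: if the Gram matrix of vectors `J_k ⊥ ℓ` is
  singular, a nontrivial combination `∑ a_k J_k` lies in `ℝℓ` — the passage from the vanishing of
  the Gram determinant of the screen Jacobi fields to a focal point (O'Neill 1983, Ch. 10,
  Prop. 30: focal points are the singular values of the normal exponential map);
* `ricci_null_eq_sum_screen` (manifold level): for the curvature of a `g`-compatible locally `C¹`
  covariant derivative, `Ric(ℓ, ℓ) = ∑ᵢ g(R(eᵢ, ℓ)ℓ, eᵢ)` over an orthonormal screen frame of the
  null vector `ℓ` — the trace in the Raychaudhuri equation only sees the screen (Hawking–Ellis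
  1973, §4.2, (4.35): `R_{ab} K^a K^b`; the directions `ℓ` and the transverse null `N` contribute
  `g(R(ℓ,ℓ)ℓ, N) = 0` and `g(R(N,ℓ)ℓ, ℓ) = 0`).

No definitions, no named facts (D-0026).

## References

* B. O'Neill, *Semi-Riemannian geometry with applications to relativity* (1983), Ch. 5,
  Lemma 5.26–Cor. 5.27, Lemma 5.28; Ch. 10, Prop. 30, Prop. 43.
* S. W. Hawking, G. F. R. Ellis, *The large scale structure of space-time* (1973), §4.2, §4.4.
* G. J. Galloway, *Maximum principles for null hypersurfaces and null splitting theorems*,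
  Ann. Henri Poincaré 1 (2000) 543–567, §2.
* P. T. Chruściel, E. Delay, G. J. Galloway, R. Howard, Ann. Henri Poincaré 2 (2001), Prop. 4.17.
-/

noncomputable section

open Set Function Module
open scoped Manifold ContDiff Topology Matrix

namespace Literature.Geometry.Lorentzian

/-! ### Lorentzian scalar products: the orthogonal space of a null vector -/

section ScalarProduct

variable {V : Type*} [NormedAddCommGroup V] [NormedSpace ℝ V] (B : V →L[ℝ] V →L[ℝ] ℝ)

/-- **A vector orthogonal to a null vector has nonnegative square** (it is spacelike or null): if
`B(w, w) < 0` then `w` is timelike and cannot be orthogonal to the causal vector `ℓ`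
(O'Neill 1983, Ch. 5, Lemma 5.26: `v^⊥` is spacelike for timelike `v`).
[cite: ONeillSemiRiemannian1983, Ch. 5, Lemma 5.26 and Cor. 5.27 (p. 141)] -/
theorem nonneg_of_orthogonal_null
    (hpos : ∀ t w : V, B t t < 0 → B t w = 0 → w ≠ 0 → 0 < B w w)
    {ℓ w : V} (hℓ0 : B ℓ ℓ = 0) (hℓ : ℓ ≠ 0) (hw : B w ℓ = 0) : 0 ≤ B w w := by
  by_contra h
  push Not at h
  have := hpos w ℓ h hw hℓ
  rw [hℓ0] at this
  exact lt_irrefl 0 this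

/-- **Two orthogonal null vectors are collinear**; more generally, if `w ⊥ ℓ` with `ℓ` null and
`B(w, w) = 0` then `w = c ℓ`. Proof (O'Neill 1983, Ch. 5, proof of Lemma 5.28 / Hawking–Ellis
1973, §4.2): for a timelike `T`, `u = B(T, w) ℓ - B(T, ℓ) w` is orthogonal to `T` with
`B(u, u) = -2 B(T,w) B(T,ℓ) B(ℓ, w) = 0`, hence `u = 0`, and `B(T, ℓ) ≠ 0`.
[cite: ONeillSemiRiemannian1983, Ch. 5, Lemma 5.28 (proof, p. 155)] [cite: HawkingEllis1973CUP, §4.2] -/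
theorem exists_smul_of_orthogonal_null (hB : ∀ v w : V, B v w = B w v)
    (hpos : ∀ t w : V, B t t < 0 → B t w = 0 → w ≠ 0 → 0 < B w w) {T : V} (hT : B T T < 0)
    {ℓ w : V} (hℓ0 : B ℓ ℓ = 0) (hℓ : ℓ ≠ 0) (hw : B w ℓ = 0) (hww : B w w = 0) :
    ∃ c : ℝ, w = c • ℓ := by
  by_cases hw0 : w = 0
  · exact ⟨0, by rw [hw0, zero_smul]⟩
  have hα : B T ℓ ≠ 0 := fun h ↦ by
    have := hpos T ℓ hT h hℓ
    rw [hℓ0] at this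
    exact lt_irrefl 0 this
  set α := B T ℓ with hα_def
  set β := B T w with hβ_def
  set u : V := β • ℓ - α • w with hu
  have hTu : B T u = 0 := by
    simp only [hu, map_sub, map_smul, smul_eq_mul]
    ring
  have huu : B u u = 0 := by
    have hwl : B ℓ w = 0 := by rw [hB]; exact hw
    simp only [hu, map_sub, map_smul, smul_eq_mul, sub_apply,
      FunLike.coe_smul, Pi.smul_apply, hℓ0, hww, hw, hwl]
    ring
  have hu0 : u = 0 := by
    by_contra hne
    have := hpos T u hT hTu hne
    rw [huu] at this
    exact lt_irrefl 0 this
  refine ⟨β / α, ?_⟩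
  have h1 : α • w = β • ℓ := (sub_eq_zero.1 (by rw [← hu]; exact hu0)).symm
  calc w = α⁻¹ • (α • w) := by rw [smul_smul, inv_mul_cancel₀ hα, one_smul]
    _ = (β / α) • ℓ := by rw [h1, smul_smul, div_eq_inv_mul]

/-- **A Lorentzian scalar product has no orthogonal basis of vectors of nonnegative square**: a
family of `dim V` pairwise `B`-orthogonal vectors with `B(fₐ, fₐ) ≥ 0` is linearly dependent —
otherwise it spans, and `B(T, T) = ∑ cₐ² B(fₐ, fₐ) ≥ 0` for the timelike `T = ∑ cₐ fₐ`
(O'Neill 1983, Ch. 3, Lemma 3.24 ff.: the index is the number of negative squares in ANY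
orthonormal basis). [cite: ONeillSemiRiemannian1983, Ch. 5, Lemma 5.26 (p. 141)] -/
theorem not_linearIndependent_of_orthogonal_of_nonneg [FiniteDimensional ℝ V] {T : V}
    (hT : B T T < 0) {κ : Type*} [Fintype κ] {f : κ → V}
    (horth : ∀ a b, a ≠ b → B (f a) (f b) = 0) (hnn : ∀ a, 0 ≤ B (f a) (f a))
    (hcard : Fintype.card κ = finrank ℝ V) : ¬ LinearIndependent ℝ f := by
  classical
  intro hli
  have hspan : Submodule.span ℝ (Set.range f) = ⊤ := hli.span_eq_top_of_card_eq_finrank' hcard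
  have hTmem : T ∈ Submodule.span ℝ (Set.range f) := by rw [hspan]; exact Submodule.mem_top
  obtain ⟨c, hc⟩ := (Submodule.mem_span_range_iff_exists_fun ℝ).1 hTmem
  have hTT : B T T = ∑ a, c a ^ 2 * B (f a) (f a) := by
    rw [← hc]
    simp only [map_sum, map_smul, FunLike.coe_sum, FunLike.coe_smul, Finset.sum_apply,
      Pi.smul_apply, smul_eq_mul]
    refine Finset.sum_congr rfl fun a _ ↦ ?_
    rw [Finset.mul_sum, Finset.sum_eq_single a]
    · ring
    · intro b _ hba
      rw [horth b a hba, mul_zero, mul_zero]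
    · intro ha; exact absurd (Finset.mem_univ a) ha
  have : 0 ≤ B T T := by
    rw [hTT]
    exact Finset.sum_nonneg fun a _ ↦ mul_nonneg (sq_nonneg _) (hnn a)
  exact absurd hT (not_lt.2 this)

/-- **`ℓ^⊥ = screen ⊕ ℝℓ`**: for an orthonormal screen frame `e₁, …, e_m` of the null vector `ℓ`
(`B(eᵢ, eⱼ) = δᵢⱼ`, `eᵢ ⊥ ℓ`, `m + 2 = dim V`) every `w ⊥ ℓ` is `∑ᵢ B(w, eᵢ) eᵢ + c ℓ` for some
`c`: the remainder `w' = w - ∑ B(w, eᵢ) eᵢ` is orthogonal to the `eᵢ` and to `ℓ`; if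
`B(w', w') = 0` it is a multiple of `ℓ` (`exists_smul_of_orthogonal_null`), and `B(w', w') > 0` is
impossible, since then `e₁, …, e_m, w', ℓ` would be `dim V` linearly independent pairwise
orthogonal vectors of nonnegative square (`not_linearIndependent_of_orthogonal_of_nonneg`).
(Galloway 2000, §2: `T_pS/K` with the induced positive definite metric; Hawking–Ellis 1973,
§4.2, the screen space spanned by `E₃, E₄`.) [cite: Galloway2000, §2] [cite: HawkingEllis1973CUP, §4.2] -/
theorem exists_eq_sum_screen_add_smul [FiniteDimensional ℝ V] (hB : ∀ v w : V, B v w = B w v)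
    (hpos : ∀ t w : V, B t t < 0 → B t w = 0 → w ≠ 0 → 0 < B w w) {T : V} (hT : B T T < 0)
    {ι : Type*} [Fintype ι] [DecidableEq ι] {e : ι → V}
    (hon : ∀ i j, B (e i) (e j) = if i = j then 1 else 0) {ℓ : V} (hℓ0 : B ℓ ℓ = 0) (hℓ : ℓ ≠ 0)
    (hℓe : ∀ i, B (e i) ℓ = 0) (hcard : Fintype.card ι + 2 = finrank ℝ V) {w : V}
    (hw : B w ℓ = 0) : ∃ c : ℝ, w = ∑ i, B w (e i) • e i + c • ℓ := by
  classical
  set w' : V := w - ∑ i, B w (e i) • e i with hw'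
  -- `w'` is orthogonal to the frame and to `ℓ`
  have hw'e : ∀ j, B w' (e j) = 0 := by
    intro j
    simp only [hw', map_sub, map_sum, map_smul, sub_apply, FunLike.coe_sum,
      FunLike.coe_smul, Finset.sum_apply, Pi.smul_apply, smul_eq_mul, hon, mul_ite, mul_one,
      mul_zero, Finset.sum_ite_eq', Finset.mem_univ, if_true, sub_self]
  have hw'ℓ : B w' ℓ = 0 := by
    simp only [hw', map_sub, map_sum, map_smul, sub_apply, FunLike.coe_sum,
      FunLike.coe_smul, Finset.sum_apply, Pi.smul_apply, smul_eq_mul, hw, hℓe, mul_zero,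
      Finset.sum_const_zero, sub_self]
  have hnn : 0 ≤ B w' w' := nonneg_of_orthogonal_null B hpos hℓ0 hℓ hw'ℓ
  rcases hnn.eq_or_lt with h0 | hpos'
  · obtain ⟨c, hc⟩ := exists_smul_of_orthogonal_null B hB hpos hT hℓ0 hℓ hw'ℓ h0.symm
    exact ⟨c, by rw [← hc, hw']; abel⟩
  · -- `e₁, …, e_m, w', ℓ` would be an impossible orthogonal family
    exfalso
    set f : Option (Option ι) → V := fun o ↦ o.elim ℓ fun o' ↦ o'.elim w' e with hf
    have hf0 : f none = ℓ := rfl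
    have hf1 : f (some none) = w' := rfl
    have hf2 : ∀ i, f (some (some i)) = e i := fun i ↦ rfl
    have horth : ∀ a b, a ≠ b → B (f a) (f b) = 0 := by
      rintro (_ | _ | i) (_ | _ | j) hab
      · exact absurd rfl hab
      · rw [hf0, hf1, hB]; exact hw'ℓ
      · rw [hf0, hf2, hB]; exact hℓe j
      · rw [hf1, hf0]; exact hw'ℓ
      · exact absurd rfl hab
      · rw [hf1, hf2]; exact hw'e j
      · rw [hf2, hf0]; exact hℓe i
      · rw [hf2, hf1, hB]; exact hw'e i
      · rw [hf2, hf2, hon]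
        have hij : i ≠ j := fun h ↦ hab (by rw [h])
        simp [hij]
    have hnn' : ∀ a, 0 ≤ B (f a) (f a) := by
      rintro (_ | _ | i)
      · rw [hf0, hℓ0]
      · rw [hf1]; exact hpos'.le
      · rw [hf2, hon]; simp
    have hcard' : Fintype.card (Option (Option ι)) = finrank ℝ V := by
      rw [Fintype.card_option, Fintype.card_option, ← hcard]
    refine not_linearIndependent_of_orthogonal_of_nonneg B hT horth hnn' hcard' ?_
    -- linear independence
    refine Fintype.linearIndependent_iff.2 fun c hc ↦ ?_
    have hpair : ∀ v : V, ∑ o, c o * B (f o) v = 0 := fun v ↦ by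
      have h := congrArg (fun z : V ↦ B z v) hc
      simpa only [map_sum, map_smul, FunLike.coe_sum, FunLike.coe_smul, Finset.sum_apply,
        Pi.smul_apply, smul_eq_mul, map_zero, zero_apply] using h
    have hci : ∀ i, c (some (some i)) = 0 := by
      intro i
      have h := hpair (e i)
      rw [Fintype.sum_option, Fintype.sum_option, hf0, hf1, hB ℓ, hℓe i, hw'e i] at h
      simp only [mul_zero, zero_add, hf2, hon] at h
      simpa using h
    have hc1 : c (some none) = 0 := by
      have h := hpair w'
      rw [Fintype.sum_option, Fintype.sum_option, hf0, hf1, hB ℓ, hw'ℓ] at h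
      simp only [mul_zero, zero_add, hf2] at h
      have hz : ∑ i, c (some (some i)) * B (e i) w' = 0 :=
        Finset.sum_eq_zero fun i _ ↦ by rw [hB, hw'e i, mul_zero]
      rw [hz, add_zero] at h
      exact (mul_eq_zero.1 h).resolve_right hpos'.ne'
    have hc0 : c none = 0 := by
      rw [Fintype.sum_option, Fintype.sum_option, hf0, hf1, hc1, zero_smul, zero_add] at hc
      have hz : ∑ i, c (some (some i)) • f (some (some i)) = 0 :=
        Finset.sum_eq_zero fun i _ ↦ by rw [hci i, zero_smul]
      rw [hz, add_zero] at hc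
      exact (smul_eq_zero.1 hc).resolve_right hℓ
    rintro (_ | _ | i)
    exacts [hc0, hc1, hci i]

/-- **Gram matrix of `ℓ`-orthogonal vectors in screen coordinates**: if each `J_k ⊥ ℓ` expands as
`J_k = ∑ᵢ B(J_k, eᵢ) eᵢ + c_k ℓ` in an orthonormal screen frame of the null vector `ℓ`, then
`(B(J_k, J_l))_{kl} = Aᵀ A` with `A = (B(J_k, eᵢ))_{ik}` — the `ℓ`-components are invisible to
`B` (only `J_k ⊥ ℓ` is used). With `J_k` the screen Jacobi fields this identifies the
frame-independent Gram determinant with `(det A)²`. [cite: HawkingEllis1973CUP, §4.2 (screen space)] -/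
theorem gram_eq_transpose_mul {ι κ : Type*} [Fintype ι] [Fintype κ] {e : ι → V} {ℓ : V}
    {J : κ → V} {c : κ → ℝ} (hJ : ∀ k, B (J k) ℓ = 0)
    (hexp : ∀ k, J k = ∑ i, B (J k) (e i) • e i + c k • ℓ) :
    (Matrix.of fun k l ↦ B (J k) (J l)) =
      (Matrix.of fun i k ↦ B (J k) (e i))ᵀ * Matrix.of fun i k ↦ B (J k) (e i) := by
  classical
  ext k l
  simp only [Matrix.of_apply, Matrix.mul_apply, Matrix.transpose_apply]
  conv_lhs => rw [hexp l]
  simp only [map_add, map_sum, map_smul, smul_eq_mul, hJ k, mul_zero, add_zero]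
  exact Finset.sum_congr rfl fun i _ ↦ by ring

/-- **A singular Gram matrix of `ℓ`-orthogonal vectors produces a combination in `ℝℓ`.** If
`J_k ⊥ ℓ` (`ℓ` null) and `det (B(J_k, J_l)) = 0`, there are coefficients `a ≠ 0` and `c` with
`∑ a_k J_k = c ℓ`: a kernel vector `a` of the Gram matrix gives `u = ∑ a_k J_k` with
`B(u, J_k) = 0` for all `k`, so `B(u, u) = 0`, and `u ⊥ ℓ` (`exists_smul_of_orthogonal_null`).
For the screen Jacobi fields of a null normal geodesic this is the focal point
(O'Neill 1983, Ch. 10, Prop. 30 (3): a nonzero kernel vector of the differential of the normal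
exponential map). [cite: ONeillSemiRiemannian1983, Ch. 10, Prop. 30] -/
theorem exists_sum_smul_eq_smul_null_of_det_gram_eq_zero (hB : ∀ v w : V, B v w = B w v)
    (hpos : ∀ t w : V, B t t < 0 → B t w = 0 → w ≠ 0 → 0 < B w w) {T : V} (hT : B T T < 0)
    {ℓ : V} (hℓ0 : B ℓ ℓ = 0) (hℓ : ℓ ≠ 0) {κ : Type*} [Fintype κ] [DecidableEq κ] {J : κ → V}
    (hJ : ∀ k, B (J k) ℓ = 0) (hdet : (Matrix.of fun k l ↦ B (J k) (J l)).det = 0) :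
    ∃ a : κ → ℝ, a ≠ 0 ∧ ∃ c : ℝ, ∑ k, a k • J k = c • ℓ := by
  obtain ⟨a, ha0, hGa⟩ := Matrix.exists_mulVec_eq_zero_iff.2 hdet
  set u : V := ∑ k, a k • J k with hu
  have hsum : ∀ v : V, B u v = ∑ k, a k * B (J k) v := fun v ↦ by
    simp only [hu, map_sum, map_smul, FunLike.coe_sum, FunLike.coe_smul, Finset.sum_apply,
      Pi.smul_apply, smul_eq_mul]
  have huk : ∀ k, B (J k) u = 0 := by
    intro k
    have h := congrFun hGa k
    simp only [Matrix.mulVec, dotProduct, Matrix.of_apply, Pi.zero_apply] at h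
    rw [hB, hsum, ← h]
    exact Finset.sum_congr rfl fun l _ ↦ by rw [hB]; ring
  have huu : B u u = 0 := by
    rw [hsum]
    exact Finset.sum_eq_zero fun k _ ↦ by rw [huk k, mul_zero]
  have huℓ : B u ℓ = 0 := by
    rw [hsum]
    exact Finset.sum_eq_zero fun k _ ↦ by rw [hJ k, mul_zero]
  obtain ⟨c, hc⟩ := exists_smul_of_orthogonal_null B hB hpos hT hℓ0 hℓ huℓ huu
  exact ⟨a, ha0, c, hc⟩

/-- **Orthonormal screen frames exist.** For a timelike `T` and a null `ℓ`, the space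
`{T, ℓ}^⊥` has dimension `dim V - 2` (the functionals `B(T, ·)`, `B(ℓ, ·)` are independent since
`B(T, ℓ) ≠ 0 = B(ℓ, ℓ)`), and `B` is positive definite on it (it lies in `T^⊥`), so it carries a
`B`-orthonormal basis (`LinearMap.BilinForm.exists_orthogonal_basis`, normalised): `m = dim V - 2`
unit spacelike vectors, pairwise orthogonal, orthogonal to `ℓ` (and to `T`). Hawking–Ellis 1973,
§4.2 (pseudo-orthonormal bases `E₁, …, E₄` with `E₄ ∥ K` null); O'Neill 1983, Ch. 5, Lemma 5.26.
[cite: HawkingEllis1973CUP, §4.2] [cite: ONeillSemiRiemannian1983, Ch. 5, Lemma 5.26] -/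
theorem exists_orthonormal_screen [FiniteDimensional ℝ V] (hB : ∀ v w : V, B v w = B w v)
    (hpos : ∀ t w : V, B t t < 0 → B t w = 0 → w ≠ 0 → 0 < B w w) {T : V} (hT : B T T < 0)
    {ℓ : V} (hℓ0 : B ℓ ℓ = 0) (hℓ : ℓ ≠ 0) :
    ∃ e : Fin (finrank ℝ V - 2) → V, (∀ i j, B (e i) (e j) = if i = j then 1 else 0) ∧
      (∀ i, B (e i) ℓ = 0) ∧ ∀ i, B (e i) T = 0 := by
  classical
  have hα : B T ℓ ≠ 0 := fun h ↦ by
    have := hpos T ℓ hT h hℓ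
    rw [hℓ0] at this
    exact lt_irrefl 0 this
  -- the map `v ↦ (B(T, v), B(ℓ, v))` is onto `ℝ²`; its kernel is `{T, ℓ}^⊥`
  set φ : V →ₗ[ℝ] ℝ × ℝ := LinearMap.prod (B T).toLinearMap (B ℓ).toLinearMap with hφ
  have hφapply : ∀ v, φ v = (B T v, B ℓ v) := fun v ↦ rfl
  have hsurj : Function.Surjective φ := by
    rintro ⟨a, b⟩
    refine ⟨(b / B T ℓ) • T + ((a - b / B T ℓ * B T T) / B T ℓ) • ℓ, ?_⟩
    rw [hφapply, Prod.mk.injEq]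
    simp only [map_add, map_smul, smul_eq_mul, hℓ0, mul_zero, add_zero, hB ℓ T]
    constructor
    · field_simp
      ring
    · field_simp
  set W : Submodule ℝ V := LinearMap.ker φ with hW
  have hWmem : ∀ v : V, v ∈ W ↔ B T v = 0 ∧ B ℓ v = 0 := fun v ↦ by
    rw [hW, LinearMap.mem_ker, hφapply, Prod.mk_eq_zero]
  have hWdim : finrank ℝ W = finrank ℝ V - 2 := by
    have h := LinearMap.finrank_range_add_finrank_ker φ
    rw [LinearMap.range_eq_top.2 hsurj, finrank_top, Module.finrank_prod, Module.finrank_self] at h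
    rw [hW]
    omega
  -- the restriction of `B` to `W` as a symmetric bilinear form, and a `B`-orthogonal basis
  set Bl : LinearMap.BilinForm ℝ V := LinearMap.mk₂ ℝ (fun v w ↦ B v w)
    (fun v₁ v₂ w ↦ by simp only [map_add, add_apply])
    (fun r v w ↦ by simp only [map_smul, FunLike.coe_smul, Pi.smul_apply, smul_eq_mul])
    (fun v w₁ w₂ ↦ by simp only [map_add]) (fun r v w ↦ by simp only [map_smul, smul_eq_mul])
    with hBl
  have hBlapply : ∀ v w, Bl v w = B v w := fun v w ↦ rfl
  have hBlsymm : LinearMap.IsSymm Bl := ⟨fun v w ↦ by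
    change B v w = B w v
    exact hB v w⟩
  haveI : Invertible (2 : ℝ) := invertibleOfNonzero two_ne_zero
  obtain ⟨b, hb⟩ := LinearMap.BilinForm.exists_orthogonal_basis (V := W)
    (LinearMap.IsSymm.domRestrict hBlsymm W)
  -- basis vectors are spacelike: normalise
  have hbpos : ∀ i, 0 < B (b i : V) (b i : V) := fun i ↦ by
    have hmem := ((hWmem (b i : V)).1 (b i).2)
    refine hpos T _ hT hmem.1 fun h ↦ b.ne_zero i ?_
    exact Subtype.ext h
  set r : Fin (finrank ℝ W) → ℝ := fun i ↦ (Real.sqrt (B (b i : V) (b i : V)))⁻¹ with hr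
  have hr2 : ∀ i, r i * r i * B (b i : V) (b i : V) = 1 := fun i ↦ by
    have hs : 0 < Real.sqrt (B (b i : V) (b i : V)) := Real.sqrt_pos.2 (hbpos i)
    rw [hr]
    field_simp
    rw [Real.sq_sqrt (hbpos i).le]
  set e : Fin (finrank ℝ W) → V := fun i ↦ r i • (b i : V) with he
  have hon : ∀ i j, B (e i) (e j) = if i = j then 1 else 0 := by
    intro i j
    simp only [he, map_smul, smul_eq_mul, FunLike.coe_smul, Pi.smul_apply]
    by_cases hij : i = j
    · subst hij
      rw [if_pos rfl, ← mul_assoc, hr2]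
    · rw [if_neg hij]
      have h : B (b i : V) (b j : V) = 0 := LinearMap.isOrthoᵢ_def.1 hb i j hij
      rw [h, mul_zero, mul_zero]
  have heℓ : ∀ i, B (e i) ℓ = 0 := fun i ↦ by
    have hmem := ((hWmem (b i : V)).1 (b i).2)
    simp only [he, map_smul, FunLike.coe_smul, Pi.smul_apply, smul_eq_mul]
    rw [hB, hmem.2, mul_zero]
  have heT : ∀ i, B (e i) T = 0 := fun i ↦ by
    have hmem := ((hWmem (b i : V)).1 (b i).2)
    simp only [he, map_smul, FunLike.coe_smul, Pi.smul_apply, smul_eq_mul]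
    rw [hB, hmem.1, mul_zero]
  refine ⟨fun j ↦ e (Fin.cast hWdim.symm j), fun i j ↦ ?_, fun i ↦ heℓ _, fun i ↦ heT _⟩
  rw [hon]
  by_cases hij : i = j
  · subst hij; simp
  · have : Fin.cast hWdim.symm i ≠ Fin.cast hWdim.symm j := fun h ↦ hij (Fin.cast_injective _ h)
    simp [hij, this]

/-- **Trace over a null-adapted basis.** For an orthonormal screen frame `e` of the null vector
`ℓ` (`m + 2 = dim V`) and a linear map `R` with `R ℓ = 0` and `B(R u, ℓ) = 0` for all `u`, the
trace of `R` is the screen trace `∑ᵢ B(R eᵢ, eᵢ)`. Proof: complete `e, ℓ` to a basis by a null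
vector `N ⊥ eᵢ` with `B(ℓ, N) = -1` (built from a timelike `T`); in this basis the coordinates of
`u` are `B(u, eᵢ)`, `-B(u, N)` (along `ℓ`) and `-B(u, ℓ)` (along `N`), and the diagonal entries
of `R` at `ℓ` and `N` are `-B(R ℓ, N) = 0` and `-B(R N, ℓ) = 0`. Applied to `R = R(·, ℓ)ℓ` this
is `Ric(ℓ, ℓ) = ∑ᵢ g(R(eᵢ, ℓ)ℓ, eᵢ)` (`ricci_null_eq_sum_screen`; Hawking–Ellis 1973, §4.2,
pseudo-orthonormal bases and (4.35)). [cite: HawkingEllis1973CUP, §4.2, (4.35)–(4.36)] -/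
theorem trace_eq_sum_screen_of_null [FiniteDimensional ℝ V] (hB : ∀ v w : V, B v w = B w v)
    (hpos : ∀ t w : V, B t t < 0 → B t w = 0 → w ≠ 0 → 0 < B w w) {T : V} (hT : B T T < 0)
    {ι : Type*} [Fintype ι] [DecidableEq ι] {e : ι → V}
    (hon : ∀ i j, B (e i) (e j) = if i = j then 1 else 0) {ℓ : V} (hℓ0 : B ℓ ℓ = 0) (hℓ : ℓ ≠ 0)
    (hℓe : ∀ i, B (e i) ℓ = 0) (hcard : Fintype.card ι + 2 = finrank ℝ V) (R : V →ₗ[ℝ] V)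
    (hRℓ : R ℓ = 0) (hRskew : ∀ u, B (R u) ℓ = 0) :
    LinearMap.trace ℝ V R = ∑ i, B (R (e i)) (e i) := by
  classical
  have hα : B T ℓ ≠ 0 := fun h ↦ by
    have := hpos T ℓ hT h hℓ
    exact lt_irrefl 0 (hℓ0 ▸ this)
  -- pairing a combination against a vector
  have hcomb : ∀ {κ : Type _} [Fintype κ] (c : κ → ℝ) (f : κ → V) (v : V),
      B (∑ o, c o • f o) v = ∑ o, c o * B (f o) v := fun c f v ↦ by
    simp only [map_sum, map_smul, FunLike.coe_sum, FunLike.coe_smul, Finset.sum_apply,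
      Pi.smul_apply, smul_eq_mul]
  -- the transverse null vector `N`: `N ⊥ eᵢ`, `B(N, N) = 0`, `B(N, ℓ) = -1`
  set N' : V := T - ∑ i, B T (e i) • e i with hN'
  have hN'e : ∀ j, B N' (e j) = 0 := by
    intro j
    rw [hN', map_sub, sub_apply, hcomb]
    simp only [hon, mul_ite, mul_one, mul_zero, Finset.sum_ite_eq', Finset.mem_univ, if_true,
      sub_self]
  have hN'ℓ : B N' ℓ = B T ℓ := by
    rw [hN', map_sub, sub_apply, hcomb]
    simp only [hℓe, mul_zero, Finset.sum_const_zero, sub_zero]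
  have hℓN' : B ℓ N' = B T ℓ := by rw [hB]; exact hN'ℓ
  set α : ℝ := B T ℓ with hαdef
  set N : V := (-α⁻¹) • (N' - (B N' N' / (2 * α)) • ℓ) with hN
  have hNv : ∀ v : V, B N v = (-α⁻¹) * (B N' v - B N' N' / (2 * α) * B ℓ v) := fun v ↦ by
    simp only [hN, map_smul, map_sub, FunLike.coe_smul, sub_apply, Pi.smul_apply, smul_eq_mul]
  have hNe : ∀ j, B N (e j) = 0 := fun j ↦ by
    rw [hNv, hN'e j, hB ℓ, hℓe j]; ring
  have hNℓ : B N ℓ = -1 := by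
    rw [hNv, hN'ℓ, hℓ0]
    field_simp
    ring
  have hNN : B N N = 0 := by
    rw [hNv, hB N' N, hNv, hB ℓ N, hNℓ, hℓN']
    field_simp
    ring
  have hℓN : B ℓ N = -1 := by rw [hB]; exact hNℓ
  -- the basis `ℓ, N, e`
  set f : Option (Option ι) → V := fun o ↦ o.elim ℓ fun o' ↦ o'.elim N fun i ↦ e i with hf
  have hf0 : f none = ℓ := rfl
  have hf1 : f (some none) = N := rfl
  have hf2 : ∀ i, f (some (some i)) = e i := fun i ↦ rfl
  have hpe : ∀ (c : Option (Option ι) → ℝ) (i : ι),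
      ∑ o, c o * B (f o) (e i) = c (some (some i)) := fun c i ↦ by
    rw [Fintype.sum_option, Fintype.sum_option, hf0, hf1, hB ℓ, hℓe i, hNe i]
    simp only [mul_zero, zero_add, hf2, hon, mul_ite, mul_one, Finset.sum_ite_eq',
      Finset.mem_univ, if_true]
  have hpN : ∀ c : Option (Option ι) → ℝ, ∑ o, c o * B (f o) N = -c none := fun c ↦ by
    rw [Fintype.sum_option, Fintype.sum_option, hf0, hf1, hℓN, hNN]
    have hz : ∑ i, c (some (some i)) * B (f (some (some i))) N = 0 :=
      Finset.sum_eq_zero fun i _ ↦ by rw [hf2, hB, hNe i, mul_zero]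
    rw [hz]; ring
  have hpℓ : ∀ c : Option (Option ι) → ℝ, ∑ o, c o * B (f o) ℓ = -c (some none) := fun c ↦ by
    rw [Fintype.sum_option, Fintype.sum_option, hf0, hf1, hℓ0, hNℓ]
    have hz : ∑ i, c (some (some i)) * B (f (some (some i))) ℓ = 0 :=
      Finset.sum_eq_zero fun i _ ↦ by rw [hf2, hℓe i, mul_zero]
    rw [hz]; ring
  have hli : LinearIndependent ℝ f := by
    refine Fintype.linearIndependent_iff.2 fun c hc0 ↦ ?_
    have hv : ∀ v : V, ∑ o, c o * B (f o) v = 0 := fun v ↦ by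
      rw [← hcomb c f v, hc0, map_zero, zero_apply]
    have hci : ∀ i, c (some (some i)) = 0 := fun i ↦ by rw [← hpe c i]; exact hv (e i)
    have hc0' : c none = 0 := by have h := hv N; rw [hpN] at h; linarith
    have hc1 : c (some none) = 0 := by have h := hv ℓ; rw [hpℓ] at h; linarith
    rintro (_ | _ | i)
    exacts [hc0', hc1, hci i]
  have hcard' : Fintype.card (Option (Option ι)) = finrank ℝ V := by
    rw [Fintype.card_option, Fintype.card_option, ← hcard]
  set b : Module.Basis (Option (Option ι)) ℝ V :=
    Module.Basis.mk hli (hli.span_eq_top_of_card_eq_finrank' hcard').ge with hb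
  have hbf : ∀ o, b o = f o := fun o ↦ by rw [hb, Module.Basis.mk_apply]
  -- coordinates in the basis `b`
  have hrepr : ∀ v : V, b.repr v none = -B v N ∧ b.repr v (some none) = -B v ℓ ∧
      ∀ i, b.repr v (some (some i)) = B v (e i) := by
    intro v
    have hsum : v = ∑ o, b.repr v o • f o := by
      conv_lhs => rw [← b.sum_repr v]
      exact Finset.sum_congr rfl fun o _ ↦ by rw [hbf]
    have hv : ∀ w : V, B v w = ∑ o, b.repr v o * B (f o) w := fun w ↦ by
      conv_lhs => rw [hsum]
      exact hcomb _ f w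
    refine ⟨?_, ?_, fun i ↦ ?_⟩
    · rw [hv N, hpN]; ring
    · rw [hv ℓ, hpℓ]; ring
    · rw [hv (e i), hpe]
  -- the trace in the basis `b`
  rw [LinearMap.trace_eq_matrix_trace ℝ b, Matrix.trace, Fintype.sum_option, Fintype.sum_option]
  simp only [Matrix.diag_apply, LinearMap.toMatrix_apply, hbf, hf0, hf1, hf2]
  rw [(hrepr _).1, (hrepr _).2.1, hRℓ, map_zero, zero_apply, neg_zero, zero_add, hRskew N,
    neg_zero, zero_add]
  exact Finset.sum_congr rfl fun i _ ↦ (hrepr _).2.2 i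

end ScalarProduct

/-! ### The Ricci curvature in a null direction is a screen trace -/

section Ricci

variable {E : Type*} [NormedAddCommGroup E] [NormedSpace ℝ E] {H : Type*} [TopologicalSpace H]
  {I : ModelWithCorners ℝ E H} {M : Type*} [TopologicalSpace M] [ChartedSpace H M]
  [IsManifold I ∞ M] [FiniteDimensional ℝ E] {n : ℕ∞ω}

/-- **`Ric(ℓ, ℓ)` is the trace of `R(·, ℓ)ℓ` over the screen.** For a Lorentzian metric `g`, a
`g`-compatible locally `C¹` covariant derivative (`n ≥ 2`), a null vector `ℓ ∈ T_xM` and an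
orthonormal screen frame `e₁, …, e_m` of `ℓ` (`m + 2 = dim M`):
`Ric(ℓ, ℓ) = ∑ᵢ g(R(eᵢ, ℓ)ℓ, eᵢ)`. Proof: complete `e, ℓ` to a basis by a null vector `N ⊥ eᵢ`
with `g(ℓ, N) = -1` (from a timelike `T`); in this basis the coordinates of `u` are
`g(u, eᵢ)`, `-g(u, N)` (along `ℓ`) and `-g(u, ℓ)` (along `N`), and the diagonal entries of
`u ↦ R(u, ℓ)ℓ` at `ℓ` and `N` are `-g(R(ℓ,ℓ)ℓ, N) = 0` and `-g(R(N,ℓ)ℓ, ℓ) = 0` (antisymmetry and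
skew-adjointness, `PseudoRiemannianMetric.val_curvature_self_eq_zero`). This is why only the
transverse (screen) directions enter the Raychaudhuri equation (Hawking–Ellis 1973, §4.2,
(4.35)–(4.36)). [cite: HawkingEllis1973CUP, §4.2, (4.35)–(4.36)] [cite: Galloway2000, §2] -/
theorem ricci_null_eq_sum_screen [CompleteSpace E] (g : LorentzianMetric I n M)
    {cov : CovariantDerivative I E (TangentSpace I : M → Type _)} (hc : g.IsCompatible cov)
    (hreg : cov.IsLocallyContMDiff 1) (hn : 2 ≤ n) (x : M) {ι : Type*} [Fintype ι] [DecidableEq ι]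
    {e : ι → TangentSpace I x} (hon : ∀ i j, g.val x (e i) (e j) = if i = j then 1 else 0)
    {ℓ : TangentSpace I x} (hℓ0 : g.val x ℓ ℓ = 0) (hℓ : ℓ ≠ 0) (hℓe : ∀ i, g.val x (e i) ℓ = 0)
    (hcard : Fintype.card ι + 2 = finrank ℝ E) :
    cov.ricci x ℓ ℓ = ∑ i, g.val x (cov.curvature x (e i) ℓ ℓ) (e i) := by
  obtain ⟨T, hT⟩ := g.exists_timelike x
  have hRℓ : cov.ricciAux x ℓ ℓ ℓ = 0 := by
    have h := cov.curvature_antisymm (x := x) ℓ ℓ ℓ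
    have h2 : (2 : ℝ) • cov.curvature x ℓ ℓ ℓ = 0 := by
      rw [two_smul]; nth_rw 1 [h]; exact neg_add_cancel _
    exact (smul_eq_zero.1 h2).resolve_left (by norm_num)
  have hRskew : ∀ u : TangentSpace I x, g.val x (cov.ricciAux x ℓ ℓ u) ℓ = 0 := fun u ↦
    PseudoRiemannianMetric.val_curvature_self_eq_zero hc hreg hn x u ℓ ℓ
  exact trace_eq_sum_screen_of_null (V := E) (g.val x) (fun v w ↦ g.symm x v w)
    (fun t w ↦ g.pos_of_orthogonal x t w) hT hon hℓ0 hℓ hℓe hcard (cov.ricciAux x ℓ ℓ) hRℓ hRskew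

end Ricci

end Literature.Geometry.Lorentzian

end
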